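import Summits.QuantumFields.BalabanUV.Beta.BorderedHessianKernelAction
import Summits.QuantumFields.BalabanUV.Beta.BorderedHessianSymmetry

/-!
# The RESIDUAL of the undressed bordered Hessian against the packed resolvent: `bhK N ∘ KInv N = resid N`,
# `resid N = [[δ + dδd ∘ GamM, 0], [0, δ_coarse]]` (β sub-cell, row BETA-an2, gen 13)

HONEST FRAMING (cell charter, verbatim): «discharging BetaPertH makes Balaban's UV stability UNCONDITIONAL — a real
constructive-QFT result; it is NOT the continuum limit and NOT the Clay problem.»  DERIVED cell leaf (pub-balaban β sub-cell, lane
an2 gen 13); no statement of Bałaban's papers is typed here, no `[cite:]` tag, no `Prop` fact; it instantiates no binder of the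
β-function wall by itself.  NOT `BetaPertH`; NOT continuum; NOT Clay.

## What is here
The packed resolvent `KInv N = [[Γ, ℋ], [ℋ♭, −𝒞]]` of the typed `U = 1` system inverts the GAUGE-FIXED bordered operator.  Against the
UNDRESSED bordered Hessian `bhK N = [[d*d, −𝒬ᵀ], [𝒬, 0]]` (no gauge rows / columns) it leaves a residual: by the column identities of
the cell ((EL) `Gam_EL` / `curvAdj_curv_Gcol`, (Q) `Gam_Q`, the minimiser column WITHOUT gauge term `curvAdj_curv_Hcol` — an5's
`wM_eq_zero` —, and `contourSum_Hcol`)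
  `bhK N ∘ KInv N = resid N`,   `resid N (inl κ x, inl l z) = (dδd M_{(l,z)})_κ(x) + δ`,   `resid N (inr κ x, inr l z) = [x = z ∧ κ = l ∧ proj N x = 0]`,
mixed blocks `0` (§2, `comp_bhK_KInv`), where `M_{(l,z)} = KKTFluctuationEnergy.Mcol l z` is the gauge multiplier of the covariance
column — the only non-Kronecker term, a PURE GAUGE form `dδd M` (the gauge-slice defect of the covariance columns).  §1 reads the
columns of `KInv N` (`fcol` / `mcol` of `BorderedHessianKernelAction`) as the cell's `Gcol`, `Φcol`, `Hcol`, `HΦcol`; §3 transposes: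
`KInv N ∘ bhK N = trK (resid N)` (`comp_KInv_bhK`, through `trK_bhK`, `trK_KInv` and the sign-conjugation gadget).

All declarations `[folklore]`; axioms standard.  Provenance: b2b-balaban β sub-cell, unit beta-an2 gen 13, 2026-08-20 (v1); over
`BorderedHessianKernel(Action)`, `BorderedHessianSymmetry`, `KKTFluctuationEnergy`, `ResolventComposition`, `OneStepResolventKernel` BY NAME.
-/

open Finset
open scoped BigOperators
open Literature.Probability.LatticeModels (TorusSite Torus.proj Torus.proj_apply)
open Literature.MathematicalPhysics.QuantumFieldTheory
open Literature.MathematicalPhysics.QuantumFieldTheory.Balaban1983to89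
open Literature.MathematicalPhysics.QuantumFieldTheory.Balaban1983to89.Beta
open B12Sec2to5 (l1 l1_nonneg)
open ExpKernelCalculus (MKer Decays BiLoc comp tr shiftK)
open AffineAveraging (Form0 Form1 Form2 box toSite unitVec unitVec_apply dz curv curvAdj codiff₁ contourSum)
open AffineReproduction (contourSumAdj curvAdj_zero)
open LatticeForm (quo)
open KKTFluctuationKernel (delta1 delta1_apply Gam GamΦ Gam_Q)
open KKTFluctuationEnergy (Gcol Mcol Φcol δcol curvAdj_curv_Gcol)
open KernelSpecInstance (wH wΦ)
open ResolventComposition (Hcol HΦcol curvAdj_curv_Hcol contourSum_Hcol)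
open OneStepResolventKernel (Fib KInv quo_zsmul eq_zsmul_quo_of_proj proj_zsmul)
open Summit.QuantumFields.BalabanUV.Beta.TameKernelCalculus

namespace Summit.QuantumFields.BalabanUV.Beta.BorderedHessian

noncomputable section

variable {d : ℕ} (N : ℕ) [NeZero N]

/-! ## §1 The columns of the packed resolvent -/

section Columns

/-- [folklore] The field column of `KInv N` at `(inl l, z)` is the covariance column `Γ_{(l,z)}`. -/
theorem fcol_KInv_inl (z : Fin (d + 1) → ℤ) (l : Fin (d + 1)) : fcol (KInv (N := N)) z (Sum.inl l) = Gcol (N := N) l z := rfl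

/-- [folklore] The multiplier column of `KInv N` at `(inl l, z)`, read on the coarse lattice, is the constraint multiplier `Φ_{(l,z)}`. -/
theorem mcol_KInv_inl (z : Fin (d + 1) → ℤ) (l : Fin (d + 1)) : mcol N (KInv (N := N)) z (Sum.inl l) = Φcol (N := N) l z := by
  funext m y'
  rw [mcol_apply, OneStepResolventKernel.KInv_inr_inl_coarse]
  rfl

/-- [folklore] The field column of `KInv N` at `(inr l, z)`, `z` coarse, is the translated minimiser column `ℋ_{(l, quo z)}`. -/
theorem fcol_KInv_inr_of_coarse {z : Fin (d + 1) → ℤ} (hz : Torus.proj N z = 0) (l : Fin (d + 1)) :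
    fcol (KInv (N := N)) z (Sum.inr l) = Hcol (N := N) l (quo N z) := by
  funext m y
  rw [fcol_apply, ResolventComposition.Hcol_apply, ← eq_zsmul_quo_of_proj hz]
  show (if Torus.proj N z = 0 then wH (N := N) m l (y - z) else 0) = wH (N := N) m l (y - z)
  rw [if_pos hz]

/-- [folklore] … and for a non-coarse `z` it vanishes. -/
theorem fcol_KInv_inr_of_not_coarse {z : Fin (d + 1) → ℤ} (hz : Torus.proj N z ≠ 0) (l : Fin (d + 1)) :
    fcol (KInv (N := N)) z (Sum.inr l) = 0 := by
  funext m y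
  rw [fcol_apply]
  exact OneStepResolventKernel.KInv_inl_inr_off hz m l y

/-- [folklore] The multiplier column of `KInv N` at `(inr l, z)`, `z` coarse, on the coarse lattice: `Φ^ℋ_{(l, quo z)}`. -/
theorem mcol_KInv_inr_of_coarse {z : Fin (d + 1) → ℤ} (hz : Torus.proj N z = 0) (l : Fin (d + 1)) :
    mcol N (KInv (N := N)) z (Sum.inr l) = HΦcol (N := N) l (quo N z) := by
  funext m y'
  rw [mcol_apply, ResolventComposition.HΦcol_apply]
  show (if Torus.proj N ((N : ℤ) • y') = 0 ∧ Torus.proj N z = 0 then wΦ (N := N) m l (quo N ((N : ℤ) • y') - quo N z) else 0) =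
    wΦ (N := N) m l (y' - quo N z)
  rw [if_pos ⟨proj_zsmul y', hz⟩, quo_zsmul]

/-- [folklore] … and for a non-coarse `z` it vanishes. -/
theorem mcol_KInv_inr_of_not_coarse {z : Fin (d + 1) → ℤ} (hz : Torus.proj N z ≠ 0) (l : Fin (d + 1)) :
    mcol N (KInv (N := N)) z (Sum.inr l) = 0 := by
  funext m y'
  rw [mcol_apply]
  show (if Torus.proj N ((N : ℤ) • y') = 0 ∧ Torus.proj N z = 0 then wΦ (N := N) m l (quo N ((N : ℤ) • y') - quo N z) else 0) = 0
  rw [if_neg (fun h => hz h.2)]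

end Columns

/-! ## §2 The residual kernel and `bhK N ∘ KInv N = resid N` -/

section Resid

/-- [folklore] **THE RESIDUAL KERNEL** `resid N := bhK N ∘ KInv N` in closed form: field–field `(dδd M_{(l,z)})_κ(x) + [κ = l ∧ x = z]`
(the gauge term of the covariance column's Euler–Lagrange identity plus its unit force), multiplier–multiplier the COARSE Kronecker
delta, mixed blocks `0`. -/
def resid (N : ℕ) [NeZero N] : MKer (d + 1) (Fib d) :=
  fun x z a b =>
    match a, b with
    | Sum.inl κ, Sum.inl l => dz (codiff₁ (dz (Mcol (N := N) l z))) κ x + (if κ = l ∧ x = z then 1 else 0)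
    | Sum.inl _, Sum.inr _ => 0
    | Sum.inr _, Sum.inl _ => 0
    | Sum.inr κ, Sum.inr l => if x = z ∧ κ = l ∧ Torus.proj N x = 0 then 1 else 0

/-- [folklore] Field–field entry of `resid`. -/
theorem resid_inl_inl (x z : Fin (d + 1) → ℤ) (κ l : Fin (d + 1)) :
    resid N x z (Sum.inl κ) (Sum.inl l) = dz (codiff₁ (dz (Mcol (N := N) l z))) κ x + (if κ = l ∧ x = z then 1 else 0) := rfl

/-- [folklore] Field–multiplier entry of `resid` vanishes. -/
theorem resid_inl_inr (x z : Fin (d + 1) → ℤ) (κ l : Fin (d + 1)) : resid N x z (Sum.inl κ) (Sum.inr l) = 0 := rfl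

/-- [folklore] Multiplier–field entry of `resid` vanishes. -/
theorem resid_inr_inl (x z : Fin (d + 1) → ℤ) (κ l : Fin (d + 1)) : resid N x z (Sum.inr κ) (Sum.inl l) = 0 := rfl

/-- [folklore] Multiplier–multiplier entry of `resid`: the coarse Kronecker delta. -/
theorem resid_inr_inr (x z : Fin (d + 1) → ℤ) (κ l : Fin (d + 1)) :
    resid N x z (Sum.inr κ) (Sum.inr l) = if x = z ∧ κ = l ∧ Torus.proj N x = 0 then 1 else 0 := rfl

/-- [folklore] The force `δcol` of `KKTFluctuationEnergy` is the indicator `delta1`. -/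
theorem δcol_eq_delta1 (l : Fin (d + 1)) (z : Fin (d + 1) → ℤ) : δcol l z = delta1 l z := rfl

/-- [folklore] **THE RESIDUAL IDENTITY** `bhK N ∘ KInv N = resid N`. -/
theorem comp_bhK_KInv : comp (bhK N) (KInv (N := N)) = resid (d := d) N := by
  funext x z a b
  rcases a with κ | κ <;> rcases b with l | l
  · -- field–field: (EL) of the covariance column minus its `𝒬ᵀΦ` term
    rw [comp_bhK_inl, fcol_KInv_inl, mcol_KInv_inl, curvAdj_curv_Gcol, resid_inl_inl]
    simp only [Pi.add_apply, δcol]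
    ring
  · -- field–multiplier: (EL) of the minimiser column has NO gauge term (`wM = 0`)
    rw [comp_bhK_inl, resid_inl_inr]
    by_cases hz : Torus.proj N z = 0
    · rw [fcol_KInv_inr_of_coarse N hz, mcol_KInv_inr_of_coarse N hz, curvAdj_curv_Hcol, sub_self]
    · rw [fcol_KInv_inr_of_not_coarse N hz, mcol_KInv_inr_of_not_coarse N hz]
      have h0 : curv (0 : Form1 (d + 1) ℝ) = 0 := by funext a c y; simp [AffineAveraging.curv]
      rw [h0, curvAdj_zero]
      simp [AffineReproduction.contourSumAdj]
  · -- multiplier–field: (Q) of the covariance column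
    rw [comp_bhK_inr, fcol_KInv_inl, resid_inr_inl]
    split_ifs with hx
    · exact Gam_Q (N := N) l z κ (quo N x)
    · rfl
  · -- multiplier–multiplier: (Q) of the minimiser column
    rw [comp_bhK_inr, resid_inr_inr]
    by_cases hx : Torus.proj N x = 0
    · rw [if_pos hx]
      by_cases hz : Torus.proj N z = 0
      · rw [fcol_KInv_inr_of_coarse N hz, contourSum_Hcol]
        have hxq : x = (N : ℤ) • quo N x := eq_zsmul_quo_of_proj hx
        have hzq : z = (N : ℤ) • quo N z := eq_zsmul_quo_of_proj hz
        by_cases h : x = z ∧ κ = l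
        · rw [if_pos ⟨by rw [h.1], h.2⟩, if_pos ⟨h.1, h.2, hx⟩]
        · rw [if_neg, if_neg (fun h' => h ⟨h'.1, h'.2.1⟩)]
          rintro ⟨hq, hκ⟩
          exact h ⟨by rw [hxq, hzq, hq], hκ⟩
      · rw [fcol_KInv_inr_of_not_coarse N hz, if_neg]
        · simp [AffineAveraging.contourSum]
        · rintro ⟨hxz, -, -⟩
          exact hz (hxz ▸ hx)
    · rw [if_neg hx, if_neg (fun h => hx h.2.2)]

end Resid

/-! ## §3 The transposed residual: `KInv N ∘ bhK N = (resid N)ᵀ` -/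

section Transposed

/-- [folklore] `resid` has vanishing mixed blocks, so `sgnK` fixes it. -/
theorem sgnK_resid : sgnK (resid (d := d) N) = resid N :=
  sgnK_eq_self (fun x y κ l => resid_inl_inr N x y κ l) (fun x y κ l => resid_inr_inl N x y κ l)

/-- [folklore] **THE LEFT RESIDUAL IDENTITY** `KInv N ∘ bhK N = trK (resid N)` (transpose of `comp_bhK_KInv` through the sign-conjugate
symmetries `trK_KInv`, `trK_bhK`). -/
theorem comp_KInv_bhK : comp (KInv (N := N)) (bhK N) = trK (resid (d := d) N) := by
  have h : trK (comp (KInv (N := N)) (bhK N)) = resid (d := d) N := by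
    rw [trK_comp, trK_bhK, trK_KInv, comp_sgnK, comp_bhK_KInv, sgnK_resid]
  have h' := congrArg trK h
  rwa [trK_trK] at h'

end Transposed

end

end Summit.QuantumFields.BalabanUV.Beta.BorderedHessian
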